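import Summits.Ventures.PercRepro.S1CoreLPTools

/-!
# PercRepro — THE TWO INCIDENCES OF THE COLOOP/CLOSURE LP: A RANK-`b` `k`-SET INSIDE A `(k + 1)`-SET (p2, gen 29;
SUBCLAIM-S1 §6.10 (xviii))

Count the pairs `(A, S)` with `A` a `k`-set of rank `b` and `S ⊇ A` a `(k + 1)`-set: there are exactly `(n − k)`
per `A`. Over `S` the pairs split by `ρ(S) ∈ {b, b + 1}`: a `(k + 1)`-set of rank `b + 1` carries at most `c` of them
(`c` = a bound on its coloops, `S1CoreLPTools`), one of rank `b` at most `k + 1` — the UPWARD incidence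
`(n − k)·m[k,b] ≤ c·m[k+1,b+1] + (k+1)·m[k+1,b]`. And the pairs whose `S` has rank `b` number at least `ms` per such
`S` and at most `f` per `A` (the extensions inside the closure) — the CLOSURE incidence `ms·m[k+1,b] ≤ f·m[k,b]`.
Nothing is claimed about any cell.

* `incPairs`, `ncard_incPairs`; **`up_incidence`**, **`closure_incidence`**.
Axioms: standard.
-/

open scoped Matroid

namespace PercRepro

namespace S1

open Set

variable {α : Type}

section Fibres

/-- A finite set covered by `|T|` fibres of size at most `c` has at most `c·|T|` elements. -/
theorem ncard_le_mul_of_fibres {β γ : Type} {X : Set β} {T : Set γ} (hT : T.Finite) (F : γ → Set β)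
    (hcover : X ⊆ ⋃ t ∈ T, F t) (hfin : ∀ t ∈ T, (F t).Finite) (c : ℕ) (hc : ∀ t ∈ T, (F t).ncard ≤ c) :
    X.ncard ≤ c * T.ncard := by
  calc X.ncard ≤ (⋃ t ∈ T, F t).ncard := ncard_le_ncard hcover (hT.biUnion hfin)
    _ ≤ ∑ᶠ t ∈ T, (F t).ncard := hT.ncard_biUnion_le _
    _ = ∑ t ∈ hT.toFinset, (F t).ncard := finsum_mem_eq_finite_toFinset_sum _ hT
    _ ≤ hT.toFinset.card • c := by
        apply Finset.sum_le_card_nsmul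
        intro t ht
        rw [Finite.mem_toFinset] at ht
        exact hc t ht
    _ = c * T.ncard := by rw [smul_eq_mul, ← ncard_eq_toFinset_card _ hT, mul_comm]

/-- A finite set containing `|T|` pairwise disjoint fibres of size at least `ms` has at least `ms·|T|` elements. -/
theorem mul_le_ncard_of_fibres {β γ : Type} {X : Set β} (hX : X.Finite) {T : Set γ} (hT : T.Finite) (F : γ → Set β)
    (hsub : ∀ t ∈ T, F t ⊆ X) (hdisj : T.PairwiseDisjoint F) (ms : ℕ) (hms : ∀ t ∈ T, ms ≤ (F t).ncard) :
    ms * T.ncard ≤ X.ncard := by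
  have hfin : ∀ t ∈ T, (F t).Finite := fun t ht => hX.subset (hsub t ht)
  calc ms * T.ncard = hT.toFinset.card • ms := by rw [smul_eq_mul, ← ncard_eq_toFinset_card _ hT, mul_comm]
    _ ≤ ∑ t ∈ hT.toFinset, (F t).ncard := by
        apply Finset.card_nsmul_le_sum
        intro t ht
        rw [Finite.mem_toFinset] at ht
        exact hms t ht
    _ = ∑ᶠ t ∈ T, (F t).ncard := (finsum_mem_eq_finite_toFinset_sum _ hT).symm
    _ = (⋃ t ∈ T, F t).ncard := (hT.ncard_biUnion hfin hdisj).symm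
    _ ≤ X.ncard := ncard_le_ncard (iUnion₂_subset hsub) hX

end Fibres

section Incidence

variable {M : Matroid α} [M.Finite]

/-- The incidences «a rank-`b` `k`-set inside a `(k + 1)`-set». -/
def incPairs (M : Matroid α) (k b : ℕ) : Set (Set α × Set α) :=
  {R : Set α × Set α | R.1 ∈ rkSets M k b ∧ R.2 ⊆ M.E ∧ R.2.ncard = k + 1 ∧ R.1 ⊆ R.2}

/-- The incidences are finite. -/
theorem incPairs_finite (k b : ℕ) : (incPairs M k b).Finite :=
  (M.ground_finite.finite_subsets.prod M.ground_finite.finite_subsets).subset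
    (fun _ hR => ⟨hR.1.1, hR.2.1⟩)

/-- A `(k + 1)`-superset of a `k`-set is `insert x` of it for a unique `x` outside. -/
theorem eq_insert_of_subset_of_ncard {A S : Set α} (hS : S.Finite) {k : ℕ} (hA : A.ncard = k) (hSk : S.ncard = k + 1)
    (hAS : A ⊆ S) : ∃ x ∈ S \ A, S = insert x A := by
  have h1 : (S \ A).ncard = 1 := by rw [ncard_sdiff' hAS hS, hSk, hA]; omega
  obtain ⟨x, hx⟩ := ncard_eq_one.mp h1
  have hxmem : x ∈ S \ A := by rw [hx]; exact mem_singleton x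
  refine ⟨x, hxmem, ?_⟩
  ext w
  constructor
  · intro hw
    by_cases hwA : w ∈ A
    · exact Or.inr hwA
    · have : w ∈ S \ A := ⟨hw, hwA⟩
      rw [hx] at this
      exact Or.inl this
  · rintro (rfl | hw)
    · exact hxmem.1
    · exact hAS hw

/-- **Every rank-`b` `k`-set has exactly `n − k` incidences.** -/
theorem ncard_incPairs (k b : ℕ) : (incPairs M k b).ncard = (M.E.ncard - k) * (rkSets M k b).ncard := by
  have hKfin := rkSets_finite (M := M) k b
  have heq : incPairs M k b = ⋃ A ∈ rkSets M k b,
      ({A} ×ˢ {S : Set α | S ⊆ M.E ∧ S.ncard = k + 1 ∧ A ⊆ S} : Set (Set α × Set α)) := by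
    ext ⟨A, S⟩
    simp only [incPairs, mem_setOf_eq, mem_iUnion, mem_prod, mem_singleton_iff, exists_prop]
    constructor
    · rintro ⟨hA, hSE, hS, hAS⟩
      exact ⟨A, hA, rfl, hSE, hS, hAS⟩
    · rintro ⟨A', hA', rfl, hSE, hS, hAS⟩
      exact ⟨hA', hSE, hS, hAS⟩
  have hfib : ∀ A ∈ rkSets M k b,
      (({A} ×ˢ {S : Set α | S ⊆ M.E ∧ S.ncard = k + 1 ∧ A ⊆ S} : Set (Set α × Set α))).Finite :=
    fun A _ => (finite_singleton A).prod (M.ground_finite.finite_subsets.subset (fun _ hS => hS.1))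
  have hdisj : (rkSets M k b).PairwiseDisjoint
      (fun A : Set α => ({A} ×ˢ {S : Set α | S ⊆ M.E ∧ S.ncard = k + 1 ∧ A ⊆ S} : Set (Set α × Set α))) := by
    intro A _ A' _ hAA
    rw [Function.onFun, Set.disjoint_left]
    rintro ⟨C, S⟩ ⟨hC1, -⟩ ⟨hC2, -⟩
    apply hAA
    rw [mem_singleton_iff] at hC1 hC2
    rw [← hC1, ← hC2]
  rw [heq, hKfin.ncard_biUnion hfib hdisj, finsum_mem_eq_finite_toFinset_sum _ hKfin]
  rw [Finset.sum_congr rfl (g := fun _ => M.E.ncard - k) ?_]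
  · rw [Finset.sum_const, smul_eq_mul, ncard_eq_toFinset_card _ hKfin, mul_comm]
  · intro A hA
    rw [Finite.mem_toFinset] at hA
    rw [ncard_prod, ncard_singleton, one_mul]
    have hAE : A ⊆ M.E := hA.1
    have hAk : A.ncard = k := hA.2.1
    have hAfin : A.Finite := M.ground_finite.subset hAE
    have himg : {S : Set α | S ⊆ M.E ∧ S.ncard = k + 1 ∧ A ⊆ S} = (fun x => insert x A) '' (M.E \ A) := by
      ext S
      simp only [mem_setOf_eq, mem_image, mem_sdiff]
      constructor
      · rintro ⟨hSE, hS, hAS⟩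
        obtain ⟨x, hx, rfl⟩ := eq_insert_of_subset_of_ncard (M.ground_finite.subset hSE) hAk hS hAS
        exact ⟨x, ⟨hSE hx.1, hx.2⟩, rfl⟩
      · rintro ⟨x, ⟨hxE, hxA⟩, rfl⟩
        exact ⟨insert_subset hxE hAE, by rw [ncard_insert_of_notMem hxA hAfin, hAk], subset_insert _ _⟩
    rw [himg, InjOn.ncard_image, ncard_sdiff' hAE M.ground_finite, hAk]
    intro x hx y hy hxy
    have hxy' : insert x A = insert y A := hxy
    have : x ∈ insert y A := hxy' ▸ mem_insert x A
    rcases this with h | h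
    · exact h
    · exact absurd h hx.2

/-- The fibre of the incidences over a `(k + 1)`-set `S` is the image of `{x ∈ S | ρ(S ∖ x) = b}` under
`x ↦ (S ∖ {x}, S)`. -/
theorem fibre_incPairs_eq (k b : ℕ) {S : Set α} (hSE : S ⊆ M.E) (hS : S.ncard = k + 1) :
    {R ∈ incPairs M k b | R.2 = S} = (fun x => (S \ {x}, S)) '' {x ∈ S | M.eRk (S \ {x}) = (b : ℕ∞)} := by
  have hSfin : S.Finite := M.ground_finite.subset hSE
  ext ⟨A, S'⟩
  simp only [mem_setOf_eq, mem_image, Prod.mk.injEq]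
  constructor
  · rintro ⟨⟨⟨hAE, hAk, hAb⟩, -, -, hAS'⟩, hS'⟩
    have hS'' : S' = S := hS'
    subst S'
    obtain ⟨x, hx, hSeq⟩ := eq_insert_of_subset_of_ncard hSfin hAk hS hAS'
    have hAx : S \ {x} = A := by
      rw [hSeq, insert_sdiff_of_mem _ (mem_singleton x), sdiff_singleton_eq_self hx.2]
    refine ⟨x, ⟨hx.1, ?_⟩, ?_, rfl⟩
    · rw [hAx]; exact hAb
    · exact hAx
  · rintro ⟨x, ⟨hxS, hxb⟩, rfl, rfl⟩
    refine ⟨⟨⟨sdiff_subset.trans hSE, ?_, hxb⟩, hSE, hS, sdiff_subset⟩, rfl⟩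
    rw [ncard_sdiff' (singleton_subset_iff.mpr hxS) hSfin, ncard_singleton, hS]
    omega

omit [M.Finite] in
/-- The map `x ↦ (S ∖ {x}, S)` is injective on `S`. -/
theorem injOn_sdiff_pair (S : Set α) (b : ℕ) :
    InjOn (fun x => (S \ {x}, S)) {x ∈ S | M.eRk (S \ {x}) = (b : ℕ∞)} := by
  intro x hx y hy hxy
  have h : S \ {x} = S \ {y} := (Prod.mk.injEq _ _ _ _).mp hxy |>.1
  by_contra hne
  have : y ∈ S \ {x} := ⟨hy.1, fun h' => hne (by rw [mem_singleton_iff] at h'; exact h'.symm)⟩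
  rw [h] at this
  exact this.2 rfl

/-- **THE UPWARD INCIDENCE**: `(n − k)·m[k,b] ≤ c·m[k+1,b+1] + (k+1)·m[k+1,b]` whenever every `(k + 1)`-set of
rank `b + 1` has at most `c` elements `x` with `ρ(S ∖ x) = b`. -/
theorem up_incidence (k b c : ℕ)
    (hc : ∀ S ⊆ M.E, S.ncard = k + 1 → M.eRk S = ((b + 1 : ℕ) : ℕ∞) →
      {x ∈ S | M.eRk (S \ {x}) = (b : ℕ∞)}.ncard ≤ c) :
    (M.E.ncard - k) * (rkSets M k b).ncard ≤
      c * (rkSets M (k + 1) (b + 1)).ncard + (k + 1) * (rkSets M (k + 1) b).ncard := by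
  have hIfin := incPairs_finite (M := M) k b
  -- split the incidences by the rank of the `(k + 1)`-set
  have hsplit : incPairs M k b ⊆ {R ∈ incPairs M k b | R.2 ∈ rkSets M (k + 1) (b + 1)} ∪
      {R ∈ incPairs M k b | R.2 ∈ rkSets M (k + 1) b} := by
    rintro ⟨A, S⟩ hR
    obtain ⟨⟨hAE, hAk, hAb⟩, hSE, hS, hAS⟩ := hR
    have hSfin : S.Finite := M.ground_finite.subset hSE
    obtain ⟨x, hx, hSeq⟩ := eq_insert_of_subset_of_ncard hSfin hAk hS hAS
    have hle : M.eRk S ≤ ((b + 1 : ℕ) : ℕ∞) := by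
      rw [hSeq]
      push_cast
      rw [← hAb]; exact M.eRk_insert_le_add_one x A
    have hge : (b : ℕ∞) ≤ M.eRk S := by rw [← hAb]; exact M.eRk_mono hAS
    have hfin : M.eRk S ≠ ⊤ := ne_top_of_le_ne_top (ENat.coe_ne_top _) hle
    obtain ⟨a, ha⟩ := ENat.ne_top_iff_exists.mp hfin
    rw [← ha] at hle hge
    have hle' : a ≤ b + 1 := by exact_mod_cast hle
    have hge' : b ≤ a := by exact_mod_cast hge
    rcases Nat.lt_or_ge a (b + 1) with hlt | hge2
    · right
      refine ⟨⟨⟨hAE, hAk, hAb⟩, hSE, hS, hAS⟩, hSE, hS, ?_⟩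
      rw [← ha]
      have : a = b := by omega
      rw [this]
    · left
      refine ⟨⟨⟨hAE, hAk, hAb⟩, hSE, hS, hAS⟩, hSE, hS, ?_⟩
      rw [← ha]
      have : a = b + 1 := by omega
      rw [this]
  have h1 : {R ∈ incPairs M k b | R.2 ∈ rkSets M (k + 1) (b + 1)}.ncard ≤ c * (rkSets M (k + 1) (b + 1)).ncard := by
    refine ncard_le_mul_of_fibres (rkSets_finite (k + 1) (b + 1)) (fun S => {R ∈ incPairs M k b | R.2 = S}) ?_
      (fun S _ => hIfin.subset (fun _ hR => hR.1)) c ?_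
    · rintro R ⟨hR, hS⟩
      rw [mem_iUnion₂]
      exact ⟨R.2, hS, hR, rfl⟩
    · rintro S ⟨hSE, hS, hSb⟩
      rw [fibre_incPairs_eq k b hSE hS]
      exact (ncard_image_le (M.ground_finite.subset hSE |>.subset (fun _ h => h.1))).trans (hc S hSE hS hSb)
  have h2 : {R ∈ incPairs M k b | R.2 ∈ rkSets M (k + 1) b}.ncard ≤ (k + 1) * (rkSets M (k + 1) b).ncard := by
    refine ncard_le_mul_of_fibres (rkSets_finite (k + 1) b) (fun S => {R ∈ incPairs M k b | R.2 = S}) ?_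
      (fun S _ => hIfin.subset (fun _ hR => hR.1)) (k + 1) ?_
    · rintro R ⟨hR, hS⟩
      rw [mem_iUnion₂]
      exact ⟨R.2, hS, hR, rfl⟩
    · rintro S ⟨hSE, hS, -⟩
      rw [fibre_incPairs_eq k b hSE hS]
      have hSfin : S.Finite := M.ground_finite.subset hSE
      refine (ncard_image_le (hSfin.subset (fun _ h => h.1))).trans ?_
      rw [← hS]
      exact ncard_le_ncard (fun _ h => h.1) hSfin
  calc (M.E.ncard - k) * (rkSets M k b).ncard = (incPairs M k b).ncard := (ncard_incPairs k b).symm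
    _ ≤ ({R ∈ incPairs M k b | R.2 ∈ rkSets M (k + 1) (b + 1)} ∪
          {R ∈ incPairs M k b | R.2 ∈ rkSets M (k + 1) b}).ncard :=
        ncard_le_ncard hsplit ((hIfin.subset (fun _ hR => hR.1)).union (hIfin.subset (fun _ hR => hR.1)))
    _ ≤ _ := ncard_union_le _ _
    _ ≤ _ := Nat.add_le_add h1 h2

/-- **THE CLOSURE INCIDENCE**: `ms·m[k+1,b] ≤ f·m[k,b]` whenever every `(k + 1)`-set of rank `b` has at least
`ms` elements `x` with `ρ(S ∖ x) = b` and every rank-`b` `k`-set has at most `f` extensions of rank `b`. -/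
theorem closure_incidence (k b ms f : ℕ)
    (hlo : ∀ S ⊆ M.E, S.ncard = k + 1 → M.eRk S = (b : ℕ∞) → ms ≤ {x ∈ S | M.eRk (S \ {x}) = (b : ℕ∞)}.ncard)
    (hhi : ∀ A ⊆ M.E, A.ncard = k → M.eRk A = (b : ℕ∞) →
      {x ∈ M.E \ A | M.eRk (insert x A) = (b : ℕ∞)}.ncard ≤ f) :
    ms * (rkSets M (k + 1) b).ncard ≤ f * (rkSets M k b).ncard := by
  have hIfin := incPairs_finite (M := M) k b
  set X := {R ∈ incPairs M k b | R.2 ∈ rkSets M (k + 1) b} with hXdef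
  have hXfin : X.Finite := hIfin.subset (fun _ hR => hR.1)
  -- lower bound: the fibres over the rank-`b` `(k + 1)`-sets
  have hlow : ms * (rkSets M (k + 1) b).ncard ≤ X.ncard := by
    refine mul_le_ncard_of_fibres hXfin (rkSets_finite (k + 1) b) (fun S => {R ∈ incPairs M k b | R.2 = S}) ?_ ?_ ms ?_
    · rintro S hS R ⟨hR, hRS⟩
      exact ⟨hR, hRS ▸ hS⟩
    · intro S _ S' _ hSS
      rw [Function.onFun, Set.disjoint_left]
      rintro R ⟨-, h1⟩ ⟨-, h2⟩
      exact hSS (h1.symm.trans h2)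
    · rintro S ⟨hSE, hS, hSb⟩
      rw [fibre_incPairs_eq k b hSE hS, InjOn.ncard_image (injOn_sdiff_pair (M := M) S b)]
      exact hlo S hSE hS hSb
  -- upper bound: the fibres over the rank-`b` `k`-sets
  have hup : X.ncard ≤ f * (rkSets M k b).ncard := by
    refine ncard_le_mul_of_fibres (rkSets_finite k b) (fun A => {R ∈ X | R.1 = A}) ?_
      (fun A _ => hXfin.subset (fun _ hR => hR.1)) f ?_
    · rintro R hR
      rw [mem_iUnion₂]
      exact ⟨R.1, hR.1.1, hR, rfl⟩
    · rintro A ⟨hAE, hAk, hAb⟩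
      have hAfin : A.Finite := M.ground_finite.subset hAE
      have hsub : {R ∈ X | R.1 = A} ⊆ (fun x => (A, insert x A)) '' {x ∈ M.E \ A | M.eRk (insert x A) = (b : ℕ∞)} := by
        rintro ⟨A', S⟩ ⟨⟨⟨-, hSE, hS, hAS⟩, -, -, hSb⟩, hAA⟩
        have hAA' : A' = A := hAA
        subst hAA'
        obtain ⟨x, hx, rfl⟩ := eq_insert_of_subset_of_ncard (M.ground_finite.subset hSE) hAk hS hAS
        exact ⟨x, ⟨⟨hSE hx.1, hx.2⟩, hSb⟩, rfl⟩
      refine (ncard_le_ncard hsub ((M.ground_finite.subset sdiff_subset |>.subset (fun _ h => h.1)).image _)).trans ?_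
      exact (ncard_image_le (M.ground_finite.subset sdiff_subset |>.subset (fun _ h => h.1))).trans (hhi A hAE hAk hAb)
  exact hlow.trans hup

end Incidence

end S1

end PercRepro
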